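import Literature.AlgebraicGeometry.HodgeTheory.MotivatedClassesDeformationInputs
import Literature.AlgebraicGeometry.HodgeTheory.HyperplaneSectionMonodromySmoothLocus
import Literature.AlgebraicGeometry.Resolution.SmoothOfRegularPerfectField
import Literature.AlgebraicGeometry.Motives.SmoothPiecesByDimension
import Literature.NumberTheory.Transcendental.AnalytificationChartsProofs
import Literature.AlgebraicGeometry.Motives.Varieties
import HarnessLib

/-!
# Route `SecondaryPeriods` — crux `RiemannWeightOne` (stmt-HodgeConjecture-16406), line `birth`: stub `stub_algebraisationSmooth`, part (R) — reduction to regularity of the local rings at complex points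

Helper file for the registered stub `stub_algebraisationSmooth` (Serre, GAGA §2 n°6–8). It reduces
`IsSmoothProjective n X` for a closed subscheme `ι : X ↪ ℙᴺ_ℂ` with CONNECTED space of complex
points to two local statements at complex points:

* (reg) every local ring `𝒪_{X,P}`, `P ∈ X(ℂ)`, is a regular local ring;
* (dim) some local ring `𝒪_{X,P}`, `P ∈ X(ℂ)`, has Krull dimension `n`.

Indeed: a regular local ring essentially of finite type over the perfect field `ℂ` is formally
smooth (Matsumura §30 Rem. 2 / Stacks 00TV, the tree's
`Resolution.formallySmooth_of_isRegularLocalRing_of_perfectField`), so every closed point lies in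
Mathlib's open `smoothLocus`, whose closed complement then has no closed point and is empty (`X` is
Jacobson) — `smooth_of_forall_complexPoints_isRegularLocalRing`; a smooth `ℂ`-scheme with connected
complex points is smooth of ONE relative dimension `d` (the tree's
`exists_smoothOfRelativeDimension_of_connectedSpace_complexPoints`) and geometrically irreducible
(`geometricallyIrreducible_of_connectedSpace_complexPoints`); and `d = dim 𝒪_{X,P} = n` at a
rational point of a standard smooth chart (`ringKrullDim_stalk_eq_of_isStandardSmoothOfRelativeDimension`).

* `mem_smoothLocus_of_isRegularLocalRing` — pointwise form of the tree's
  `smooth_of_isRegular_of_perfectField`;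
* `smooth_of_forall_complexPoints_isRegularLocalRing`;
* `isSmoothProjective_of_forall_isRegularLocalRing` — **the reduction**.

## References

* [Matsumura1987] H. Matsumura, Commutative Ring Theory, §30 Remark 2 after Thm. 30.3.
* [StacksProject] Tags 00TV, 056S, 01TB.
* [GortzWedhorn2020] U. Görtz, T. Wedhorn, Algebraic Geometry I, Thm. 6.28, Lemma 6.26.
* [SerreGAGA1956] J.-P. Serre, GAGA, §2 n°6 Prop. 3 and Cor.
-/

noncomputable section

-- every declaration of this problem lives in `Summit.HodgeConjecture.HodgeConjecture.…`
set_option linter.dupNamespace false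

namespace Summit.HodgeConjecture.HodgeConjecture.Theorems.RiemannWeightOne

open CategoryTheory AlgebraicGeometry TopologicalSpace
open Literature.AlgebraicGeometry.Motives

universe u

/-! ### Regular local ring at a point ⇒ smooth point (perfect base field) -/

/-- **A point with regular local ring is a smooth point**, for a scheme locally of finite type over
a perfect field `k` (Stacks 00TV: a regular local ring essentially of finite type over a perfect
field is formally smooth; the stalk of `Spec k` is a localisation of `k`, hence formally étale over
`k`). Pointwise form of the tree's `Resolution.smooth_of_isRegular_of_perfectField`.
[cite: Matsumura1987, §30 Remark 2 after Thm. 30.3] [cite: StacksProject, Tag 00TV] -/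
theorem mem_smoothLocus_of_isRegularLocalRing {k : Type u} [Field k] [PerfectField k]
    {Y : Scheme.{u}} (f : Y ⟶ Spec (CommRingCat.of k)) [LocallyOfFiniteType f] (x : Y)
    (hx : IsRegularLocalRing (Y.presheaf.stalk x)) : x ∈ f.smoothLocus := by
  -- adapted from `Literature.AlgebraicGeometry.Resolution.smooth_of_isRegular_of_perfectField`
  rw [Scheme.Hom.mem_smoothLocus]
  let R := (Spec (CommRingCat.of k)).presheaf.stalk (f.base x)
  let S := Y.presheaf.stalk x
  letI algRS : Algebra R S := (f.stalkMap x).hom.toAlgebra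
  letI algkR : Algebra k R := StructureSheaf.stalkAlgebra (↑(CommRingCat.of k)) (f.base x)
  haveI : IsLocalization.AtPrime R (f.base x).asIdeal :=
    StructureSheaf.IsLocalization.to_stalk (↑(CommRingCat.of k)) (f.base x)
  haveI : Algebra.FormallyEtale k R := Algebra.FormallyEtale.of_isLocalization (f.base x).asIdeal.primeCompl
  haveI : Algebra.EssFiniteType k R :=
    Algebra.EssFiniteType.of_isLocalization R (f.base x).asIdeal.primeCompl
  letI algkS : Algebra k S := ((algebraMap R S).comp (algebraMap k R)).toAlgebra
  haveI : IsScalarTower k R S := IsScalarTower.of_algebraMap_eq' rfl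
  haveI : Algebra.EssFiniteType R S := LocallyOfFiniteType.stalkMap f x
  haveI : Algebra.EssFiniteType k S := Algebra.EssFiniteType.comp k R S
  haveI : IsRegularLocalRing S := hx
  have hkS : Algebra.FormallySmooth k S :=
    Literature.AlgebraicGeometry.Resolution.formallySmooth_of_isRegularLocalRing_of_perfectField k S
  exact (Algebra.FormallySmooth.iff_restrictScalars (R := k) (A := R) (B := S)).mp hkS

/-- **Regular local rings at all complex points ⇒ smooth over `ℂ`**, for `X` locally of finite type
over `ℂ`: the complex points are the closed points (Nullstellensatz), they lie in the open smooth
locus (`mem_smoothLocus_of_isRegularLocalRing`), whose closed complement therefore contains no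
closed point and is empty, `X` being Jacobson. [cite: StacksProject, Tag 00TV] [cite: GortzWedhorn2020, Thm. 6.28] -/
theorem smooth_of_forall_complexPoints_isRegularLocalRing {X : SchemeOver ℂ} [LocallyOfFiniteType X.hom]
    (hreg : ∀ P : ComplexPoints X, IsRegularLocalRing (X.left.presheaf.stalk P.pt)) :
    Smooth X.hom := by
  rw [← Scheme.Hom.smoothLocus_eq_top_iff]
  haveI := ComplexPoints.jacobsonSpace_left (X := X)
  -- the closed complement of the smooth locus has no closed point
  by_contra hne
  have hne' : ((X.hom.smoothLocus : Set X.left)ᶜ).Nonempty := by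
    by_contra h
    rw [Set.not_nonempty_iff_eq_empty, Set.compl_empty_iff] at h
    exact hne (Opens.ext h)
  obtain ⟨y, hy, hyc⟩ := nonempty_inter_closedPoints hne'
    X.hom.smoothLocus.isOpen.isClosed_compl.isLocallyClosed
  rw [← ComplexPoints.range_pt] at hyc
  obtain ⟨P, rfl⟩ := hyc
  exact hy (mem_smoothLocus_of_isRegularLocalRing X.hom P.pt (hreg P))

/-! ### The reduction -/

/-- **Reduction of `IsSmoothProjective n X` to the local rings at complex points.** Let
`ι : X ↪ ℙᴺ_ℂ` be a closed subscheme whose space of complex points `X(ℂ)` is connected, all of whose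
local rings at complex points are regular, one of them of dimension `n`. Then `X` is smooth
projective of dimension `n` over `ℂ`: smooth (`smooth_of_forall_complexPoints_isRegularLocalRing`),
hence smooth of one relative dimension `d` (`X(ℂ)` connected,
`exists_smoothOfRelativeDimension_of_connectedSpace_complexPoints`) and geometrically irreducible
(`geometricallyIrreducible_of_connectedSpace_complexPoints`), with `d = dim 𝒪_{X,P} = n`
(`ringKrullDim_stalk_eq_of_isStandardSmoothOfRelativeDimension`); projective by `ι`.
[cite: SerreGAGA1956, §2 n°6 Prop. 3 and Cor. 2] [cite: GortzWedhorn2020, Thm. 6.28 and Lemma 6.26] -/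
theorem isSmoothProjective_of_forall_isRegularLocalRing {n N : ℕ} {X : SchemeOver ℂ}
    (ι : X ⟶ projectiveSpace N ℂ) [IsClosedImmersion ι.left] [ConnectedSpace (ComplexPoints X)]
    (hreg : ∀ P : ComplexPoints X, IsRegularLocalRing (X.left.presheaf.stalk P.pt))
    (hdim : ∃ P : ComplexPoints X, ringKrullDim (X.left.presheaf.stalk P.pt) = n) :
    IsSmoothProjective n X := by
  haveI : IsProper X.hom := by rw [← Over.w ι]; infer_instance
  haveI : LocallyOfFiniteType X.hom := inferInstance
  haveI : Smooth X.hom := smooth_of_forall_complexPoints_isRegularLocalRing hreg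
  obtain ⟨d, hd⟩ :=
    Literature.AlgebraicGeometry.HodgeTheory.exists_smoothOfRelativeDimension_of_connectedSpace_complexPoints X
  haveI := hd
  -- `d = n`
  obtain ⟨P, hP⟩ := hdim
  obtain ⟨V, hV, hPV, hsm⟩ := AlgPoints.exists_isStandardSmoothOfRelativeDimension_scalarRingHom d P
  have hd' := ringKrullDim_stalk_eq_of_isStandardSmoothOfRelativeDimension hV hsm P hPV
  rw [hP] at hd'
  have hdn : d = n := by exact_mod_cast hd'.symm
  subst hdn
  exact ⟨hd, ⟨N, ι, inferInstance⟩, geometricallyIrreducible_of_connectedSpace_complexPoints d⟩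

/-- **Registered sub-goal `stub_algebraisationSmooth_reduction`** of the stub
`stub_algebraisationSmooth` (the reduction to the local rings at complex points,
`isSmoothProjective_of_forall_isRegularLocalRing`). [cite: SerreGAGA1956, §2 n°6 Prop. 3 and Cor. 2] -/
theorem stub_algebraisationSmooth_reduction :
    ∀ ⦃n N : ℕ⦄ ⦃X : SchemeOver ℂ⦄ (ι : X ⟶ projectiveSpace N ℂ) [IsClosedImmersion ι.left]
      [ConnectedSpace (ComplexPoints X)],
      (∀ P : ComplexPoints X, IsRegularLocalRing (X.left.presheaf.stalk P.pt)) →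
      (∃ P : ComplexPoints X, ringKrullDim (X.left.presheaf.stalk P.pt) = n) →
      IsSmoothProjective n X :=
  fun _ _ _ ι _ _ hreg hdim => isSmoothProjective_of_forall_isRegularLocalRing ι hreg hdim

end Summit.HodgeConjecture.HodgeConjecture.Theorems.RiemannWeightOne

end
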